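import Summits.AnomalousDissipation.AnomalousDissipation.Theorems.MarginalStabilityChainBurgersLayerKHStubResolventUniqueA

/-!
# Stub `stub_resolventUnique` of the line `Sketch` (crux stmt-AnomalousDissipation-3008), part B:
# the Weber energy lemma

Registered stub (proved in `MarginalStabilityChainBurgersLayerKHStubResolventUnique.lean`, which imports
this file):
`theorem stub_resolventUnique : ∀ α : ℝ, 0 < α → α ≤ 1 → ∀ lam : ℂ, 0 < lam.re → ∀ h : ℝ, 0 < h →
ResolventUniqueAt α h lam`.

This part file proves the **Weber energy lemma** (registered sub-goal `resolventUnique_partB` = the complex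
form `weber_complex` in Pi-form): a bounded, twice differentiable `W : ℝ → ℂ` with
`W'' = (y²/4 + μ + iν(y)) W`, `μ > −½` real, `ν` real-valued, vanishes identically.  Proof: with
`a = re W`, `b = im W` the `iν` terms cancel in `a''a + b''b = (y²/4 + μ)(a² + b²)`; the forced energy
inequality `weber_energy_forced` (`(μ + ½) ∫ (a² + b²) ≤ −∫ r`, from the energy identity
`∫ (a'² + b'² + (y²/4 + μ)(a² + b²) + r) = 0` — boundary terms vanish along suitable sequences — and the
Hermite ground-state bound `∫ (a'² + (y²/4) a²) ≥ ½ ∫ a²`, obtained by integrating `(a' + (y/2) a)² ≥ 0`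
by parts) with `r = 0` gives `∫ (a² + b²) = 0`.

TRANSPLANTED verbatim (renamed into this namespace) from §0 of the crux's standing-adversary file
`Cruxes/BurgersLayerKH/Disproof.lean` (refuter-cdisprove, 2026-08-16; sorry-free, not importable from
`Theorems/`); the integrability bootstrap is part A.  Pure proof file (no definitions).
-/

-- `Summit.<Summit>.<Problem>` is the tree's mandated summit-side namespace (CONVENTIONS §2); for this
-- single-conjunct summit the two coincide, so the duplicate is deliberate.
set_option linter.dupNamespace false

noncomputable section

open Filter Set MeasureTheory Topology intervalIntegral Complex

namespace Summit.AnomalousDissipation.AnomalousDissipation.Theorems.BurgersLayerKH.Sheet.ResolventUnique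

-- §0 of Cruxes/BurgersLayerKH/Disproof.lean, second half
-- adapted from Cruxes/BurgersLayerKH/Disproof.lean (refuter-cdisprove, 2026-08-16)

/-- **Weber energy inequality (forced).** If `a, b : ℝ → ℝ` are twice differentiable, `a² + b²`
is bounded, `r` is continuous and integrable, and `a'' a + b'' b = (y²/4 + μ)(a² + b²) + r`
pointwise, then `(μ + ½) ∫ (a² + b²) ≤ −∫ r`. (Real and imaginary parts of a bounded solution of
`W'' = (y²/4 + μ + iν(y))W + f`, `r = re (f W̄)`; the proof is the energy identity
`∫ (|W'|² + (y²/4 + μ)|W|² + r) = 0` — boundary terms vanish along suitable sequences — combined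
with the Hermite ground-state bound `∫ |W'|² + (y²/4)|W|² ≥ ½ ∫ |W|²`.) [folklore] -/
theorem weber_energy_forced {a b a₁ b₁ a₂ b₂ r : ℝ → ℝ} {μ B : ℝ}
    (ha : ∀ y, HasDerivAt a (a₁ y) y) (ha₁ : ∀ y, HasDerivAt a₁ (a₂ y) y)
    (hb : ∀ y, HasDerivAt b (b₁ y) y) (hb₁ : ∀ y, HasDerivAt b₁ (b₂ y) y)
    (hB : ∀ y, a y ^ 2 + b y ^ 2 ≤ B) (hrc : Continuous r) (hri : Integrable r)
    (heq : ∀ y, a₂ y * a y + b₂ y * b y = (y ^ 2 / 4 + μ) * (a y ^ 2 + b y ^ 2) + r y) :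
    (μ + 1 / 2) * ∫ y, (a y ^ 2 + b y ^ 2) ≤ -∫ y, r y := by
  obtain ⟨inn, im, iy2n⟩ := weber_integrable ha ha₁ hb hb₁ hB hrc hri heq
  -- the players
  set n : ℝ → ℝ := fun y => a y ^ 2 + b y ^ 2 with hn_def
  set m : ℝ → ℝ := fun y => a₁ y ^ 2 + b₁ y ^ 2 with hm_def
  set F : ℝ → ℝ := fun y => a₁ y * a y + b₁ y * b y with hF_def
  set V : ℝ → ℝ := fun y => y ^ 2 / 4 + μ with hV_def
  have hn0 : ∀ y, 0 ≤ n y := fun y => by simp only [hn_def]; positivity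
  have hm0 : ∀ y, 0 ≤ m y := fun y => by simp only [hm_def]; positivity
  -- continuity
  have ca : Continuous a := continuous_iff_continuousAt.2 fun y => (ha y).continuousAt
  have ca₁ : Continuous a₁ := continuous_iff_continuousAt.2 fun y => (ha₁ y).continuousAt
  have cb : Continuous b := continuous_iff_continuousAt.2 fun y => (hb y).continuousAt
  have cb₁ : Continuous b₁ := continuous_iff_continuousAt.2 fun y => (hb₁ y).continuousAt
  have cn : Continuous n := by simp only [hn_def]; fun_prop
  have cm : Continuous m := by simp only [hm_def]; fun_prop
  have cF : Continuous F := by simp only [hF_def]; fun_prop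
  have cV : Continuous V := by simp only [hV_def]; fun_prop
  -- derivatives of `n` and `F`
  have hnd : ∀ y, HasDerivAt n (2 * F y) y := by
    intro y
    have h := ((ha y).fun_mul (ha y)).fun_add ((hb y).fun_mul (hb y))
    have e : n = fun x => a x * a x + b x * b x := by funext x; simp only [hn_def]; ring
    rw [e]
    refine h.congr_deriv ?_
    simp only [hF_def]; ring
  have hFd : ∀ y, HasDerivAt F (m y + V y * n y + r y) y := by
    intro y
    have h := ((ha₁ y).fun_mul (ha y)).fun_add ((hb₁ y).fun_mul (hb y))
    rw [hF_def]
    refine h.congr_deriv ?_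
    simp only [hm_def, hV_def, hn_def]
    linear_combination heq y
  have iFTC : ∀ s t, ∫ y in s..t, (m y + V y * n y + r y) = F t - F s :=
    fun s t => ftc hFd (by fun_prop) s t
  -- integrability of everything in sight
  have iVn : Integrable (fun y => V y * n y) := by
    refine ((iy2n.div_const 4).add (inn.const_mul μ)).congr (Eventually.of_forall fun y => ?_)
    simp only [Pi.add_apply, hV_def]; ring
  have iy2n' : Integrable (fun y => y ^ 2 / 4 * n y) := by
    refine (iy2n.div_const 4).congr (Eventually.of_forall fun y => ?_)
    simp only; ring
  have hFabs : ∀ y, |F y| ≤ (m y + n y) / 2 := by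
    intro y
    simp only [hF_def, hm_def, hn_def]
    rw [abs_le]
    constructor
    · nlinarith [sq_nonneg (a₁ y + a y), sq_nonneg (b₁ y + b y)]
    · nlinarith [sq_nonneg (a₁ y - a y), sq_nonneg (b₁ y - b y)]
  have iF : Integrable F := by
    refine ((im.add inn).div_const 2).mono' cF.aestronglyMeasurable (Eventually.of_forall fun y => ?_)
    rw [Real.norm_eq_abs]
    simpa using hFabs y
  have iG : Integrable (fun y => |F y| + y ^ 2 * n y) := iF.abs.add iy2n
  have iH : Integrable (fun y => m y + y ^ 2 / 4 * n y) := im.add iy2n'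
  have iMV : Integrable (fun y => m y + V y * n y + r y) := (im.add iVn).add hri
  -- Step C: points where both boundary quantities are small
  have ptTop : ∀ ε, 0 < ε → ∀ R, ∃ t, R ≤ t ∧ 1 ≤ t ∧ |F t| ≤ ε ∧ t * n t ≤ ε := by
    intro ε hε R
    obtain ⟨t, ht, hG⟩ := exists_ge_abs_le iG hε (max R 1)
    have hR : R ≤ t := le_trans (le_max_left _ _) ht
    have h1 : 1 ≤ t := le_trans (le_max_right _ _) ht
    have hG' : |F t| + t ^ 2 * n t ≤ ε := by
      have := (abs_le.1 hG).2
      simpa using this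
    have hnt := hn0 t
    have hFt := abs_nonneg (F t)
    have key : 0 ≤ t * (t - 1) * n t := mul_nonneg (mul_nonneg (by linarith) (by linarith)) hnt
    refine ⟨t, hR, h1, ?_, ?_⟩
    · nlinarith only [hG', hnt, hFt, h1]
    · linarith only [hG', hFt, key]
  have ptBot : ∀ ε, 0 < ε → ∀ R, ∃ s, s ≤ R ∧ s ≤ -1 ∧ |F s| ≤ ε ∧ -s * n s ≤ ε := by
    intro ε hε R
    obtain ⟨s, hs, hG⟩ := exists_le_abs_le iG hε (min R (-1))
    have hR : s ≤ R := le_trans hs (min_le_left _ _)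
    have h1 : s ≤ -1 := le_trans hs (min_le_right _ _)
    have hG' : |F s| + s ^ 2 * n s ≤ ε := by
      have := (abs_le.1 hG).2
      simpa using this
    have hns := hn0 s
    have hFs := abs_nonneg (F s)
    have key : 0 ≤ (-s) * (-s - 1) * n s := mul_nonneg (mul_nonneg (by linarith) (by linarith)) hns
    refine ⟨s, hR, h1, ?_, ?_⟩
    · nlinarith only [hG', hns, hFs, h1]
    · linarith only [hG', hFs, key]
  -- Step D: the limiting identities
  set I₁ : ℝ := ∫ y, (m y + V y * n y + r y) with hI₁
  set Ir : ℝ := ∫ y, r y with hIr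
  set I₂ : ℝ := ∫ y, n y with hI₂
  set I₃ : ℝ := ∫ y, (m y + y ^ 2 / 4 * n y) with hI₃
  have hI₁0 : I₁ = 0 := by
    have key : ∀ ε, 0 < ε → |I₁| ≤ 3 * ε := by
      intro ε hε
      obtain ⟨R, hR⟩ := tail_uniform iMV hε
      obtain ⟨t, hRt, -, hFt, -⟩ := ptTop ε hε R
      obtain ⟨s, hsR, -, hFs, -⟩ := ptBot ε hε (-R)
      have hint := hR s t hsR hRt
      rw [iFTC s t] at hint
      have e1 := abs_le.1 hint
      have e2 := abs_le.1 hFt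
      have e3 := abs_le.1 hFs
      rw [abs_le]; constructor <;> linarith only [e1.1, e1.2, e2.1, e2.2, e3.1, e3.2]
    by_contra hne
    have hpos : 0 < |I₁| := abs_pos.2 hne
    have := key (|I₁| / 6) (by positivity)
    linarith only [this, hpos]
  have hI₂I₃ : I₂ / 2 ≤ I₃ := by
    apply le_of_forall_pos_le_add
    intro ε' hε'
    set ε : ℝ := ε' / 3 with hεdef
    have hε : 0 < ε := by positivity
    obtain ⟨R₃, hR₃⟩ := tail_uniform iH hε
    obtain ⟨R₂, hR₂⟩ := tail_uniform inn hε
    obtain ⟨t, hRt, h1t, -, hnt⟩ := ptTop ε hε (max R₃ R₂)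
    obtain ⟨s, hsR, hs1, -, hns⟩ := ptBot ε hε (-max R₃ R₂)
    have hst : s ≤ t := by linarith only [hRt, hsR, h1t, hs1]
    -- integration by parts of `y F = (y/2) n'`
    set φ : ℝ → ℝ := fun y => y / 2 * n y with hφ_def
    have hφd : ∀ y, HasDerivAt φ (n y / 2 + y * F y) y := by
      intro y
      have h := ((hasDerivAt_id' y).div_const 2).fun_mul (hnd y)
      rw [hφ_def]
      refine h.congr_deriv ?_
      ring
    have iparts : ∫ y in s..t, (n y / 2 + y * F y) = φ t - φ s := ftc hφd (by fun_prop) s t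
    have hpt : ∀ y, n y / 2 - (n y / 2 + y * F y) ≤ m y + y ^ 2 / 4 * n y := by
      intro y
      simp only [hn_def, hm_def, hF_def]
      nlinarith [sq_nonneg (a₁ y + y / 2 * a y), sq_nonneg (b₁ y + y / 2 * b y)]
    have h1 : ∫ y in s..t, (n y / 2 - (n y / 2 + y * F y)) ≤ ∫ y in s..t, (m y + y ^ 2 / 4 * n y) :=
      integral_mono_on hst
        ((by fun_prop : Continuous fun y => n y / 2 - (n y / 2 + y * F y)).intervalIntegrable _ _)
        ((by fun_prop : Continuous fun y => m y + y ^ 2 / 4 * n y).intervalIntegrable _ _)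
        fun y _ => hpt y
    have h2 : ∫ y in s..t, (n y / 2 - (n y / 2 + y * F y))
        = (∫ y in s..t, n y) / 2 - (φ t - φ s) := by
      rw [integral_sub ((by fun_prop : Continuous fun y => n y / 2).intervalIntegrable _ _)
        ((by fun_prop : Continuous fun y => n y / 2 + y * F y).intervalIntegrable _ _), iparts,
        intervalIntegral.integral_div]
    have hφt : φ t ≤ ε / 2 := by
      have e : φ t = (t * n t) / 2 := by simp only [hφ_def]; ring
      rw [e]; linarith only [hnt]
    have hφs : -(ε / 2) ≤ φ s := by
      have e : φ s = -((-s * n s) / 2) := by simp only [hφ_def]; ring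
      rw [e]; linarith only [hns]
    have e3 := abs_le.1 (hR₃ s t (by linarith only [hsR, le_max_left R₃ R₂])
      (le_trans (le_max_left _ _) hRt))
    have e2 := abs_le.1 (hR₂ s t (by linarith only [hsR, le_max_right R₃ R₂])
      (le_trans (le_max_right _ _) hRt))
    have hfin : I₂ / 2 ≤ I₃ + 5 * ε / 2 := by
      linarith only [h1, h2, hφt, hφs, e3.1, e3.2, e2.1, e2.2]
    have : 5 * ε / 2 ≤ ε' := by rw [hεdef]; linarith only [hε']
    linarith only [hfin, this]
  have hI₁split : I₁ = I₃ + μ * I₂ + Ir := by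
    have e1 : ∫ y, (m y + V y * n y + r y) = (∫ y, (m y + V y * n y)) + ∫ y, r y :=
      integral_add (im.add iVn) hri
    have e2 : ∫ y, (m y + V y * n y) = (∫ y, (m y + y ^ 2 / 4 * n y)) + μ * ∫ y, n y := by
      rw [← MeasureTheory.integral_const_mul, ← integral_add iH (inn.const_mul μ)]
      exact integral_congr_ae (Eventually.of_forall fun y => by simp only [hV_def]; ring)
    simp only [hI₁, hI₂, hI₃, hIr]
    rw [e1, e2]
  have h5 : (μ + 1 / 2) * I₂ ≤ -Ir := by linarith only [hI₁0, hI₁split, hI₂I₃]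
  simpa only [hI₂, hIr, hn_def] using h5

/-- **Weber energy lemma.** If `a, b : ℝ → ℝ` are twice differentiable, `a² + b²` is bounded, and
`a'' a + b'' b = (y²/4 + μ)(a² + b²)` pointwise with `μ > −1/2`, then `a ≡ b ≡ 0` (the unforced
case of `weber_energy_forced`: `(μ + ½)∫(a² + b²) ≤ 0`). [folklore] -/
theorem weber_energy {a b a₁ b₁ a₂ b₂ : ℝ → ℝ} {μ B : ℝ}
    (ha : ∀ y, HasDerivAt a (a₁ y) y) (ha₁ : ∀ y, HasDerivAt a₁ (a₂ y) y)
    (hb : ∀ y, HasDerivAt b (b₁ y) y) (hb₁ : ∀ y, HasDerivAt b₁ (b₂ y) y)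
    (hB : ∀ y, a y ^ 2 + b y ^ 2 ≤ B)
    (heq : ∀ y, a₂ y * a y + b₂ y * b y = (y ^ 2 / 4 + μ) * (a y ^ 2 + b y ^ 2))
    (hμ : -1 / 2 < μ) (y₀ : ℝ) : a y₀ = 0 ∧ b y₀ = 0 := by
  have heq' : ∀ y, a₂ y * a y + b₂ y * b y
      = (y ^ 2 / 4 + μ) * (a y ^ 2 + b y ^ 2) + (fun _ => (0:ℝ)) y :=
    fun y => by simp only [heq y, add_zero]
  obtain ⟨inn, -, -⟩ :=
    weber_integrable ha ha₁ hb hb₁ hB continuous_const (integrable_zero _ _ _) heq'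
  have h := weber_energy_forced ha ha₁ hb hb₁ hB continuous_const (integrable_zero _ _ _) heq'
  have e0 : (∫ _y : ℝ, (0 : ℝ)) = 0 := by simp
  have h' : (μ + 1 / 2) * ∫ y, (a y ^ 2 + b y ^ 2) ≤ 0 := by
    calc (μ + 1 / 2) * ∫ y, (a y ^ 2 + b y ^ 2) ≤ -∫ _y : ℝ, (0 : ℝ) := h
      _ = 0 := by rw [e0, neg_zero]
  have hn0 : ∀ y, 0 ≤ a y ^ 2 + b y ^ 2 := fun y => by positivity
  have hI0 : 0 ≤ ∫ y, (a y ^ 2 + b y ^ 2) := integral_nonneg hn0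
  have hI : ∫ y, (a y ^ 2 + b y ^ 2) = 0 := by
    by_contra hne
    have hpos : 0 < ∫ y, (a y ^ 2 + b y ^ 2) := lt_of_le_of_ne hI0 (Ne.symm hne)
    have : 0 < (μ + 1 / 2) * ∫ y, (a y ^ 2 + b y ^ 2) := mul_pos (by linarith) hpos
    linarith
  have ca : Continuous a := continuous_iff_continuousAt.2 fun y => (ha y).continuousAt
  have cb : Continuous b := continuous_iff_continuousAt.2 fun y => (hb y).continuousAt
  have cn : Continuous fun y => a y ^ 2 + b y ^ 2 := by fun_prop
  have hn_ae := (integral_eq_zero_iff_of_nonneg hn0 inn).1 hI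
  have hn_zero := (cn.ae_eq_iff_eq volume continuous_const).1 hn_ae
  have hy : a y₀ ^ 2 + b y₀ ^ 2 = 0 := congrFun hn_zero y₀
  have ha2 : a y₀ ^ 2 = 0 := by nlinarith only [hy, sq_nonneg (a y₀), sq_nonneg (b y₀)]
  have hb2 : b y₀ ^ 2 = 0 := by nlinarith only [hy, sq_nonneg (a y₀), sq_nonneg (b y₀)]
  exact ⟨pow_eq_zero_iff two_ne_zero |>.1 ha2, pow_eq_zero_iff two_ne_zero |>.1 hb2⟩

/-- **Weber energy lemma, complex form.** A bounded `W : ℝ → ℂ`, twice differentiable, with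
`W'' = (y²/4 + μ + iν(y)) W` for a real constant `μ > −1/2` and any real function `ν`, vanishes
identically. (Apply `weber_energy` to `a = re W`, `b = im W`: the `iν` terms cancel in
`a'' a + b'' b`.) [folklore] -/
theorem weber_complex {W W₁ W₂ : ℝ → ℂ} {μ C : ℝ} (ν : ℝ → ℝ)
    (hW : ∀ y, HasDerivAt W (W₁ y) y) (hW₁ : ∀ y, HasDerivAt W₁ (W₂ y) y)
    (hC : ∀ y, ‖W y‖ ≤ C)
    (heq : ∀ y, W₂ y = ((y : ℂ) ^ 2 / 4 + (μ : ℂ) + Complex.I * (ν y : ℂ)) * W y)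
    (hμ : -1 / 2 < μ) (y₀ : ℝ) : W y₀ = 0 := by
  have ha : ∀ y, HasDerivAt (fun y => (W y).re) ((W₁ y).re) y := fun y => by
    simpa [Function.comp_def] using Complex.reCLM.hasFDerivAt.comp_hasDerivAt y (hW y)
  have ha₁ : ∀ y, HasDerivAt (fun y => (W₁ y).re) ((W₂ y).re) y := fun y => by
    simpa [Function.comp_def] using Complex.reCLM.hasFDerivAt.comp_hasDerivAt y (hW₁ y)
  have hb : ∀ y, HasDerivAt (fun y => (W y).im) ((W₁ y).im) y := fun y => by
    simpa [Function.comp_def] using Complex.imCLM.hasFDerivAt.comp_hasDerivAt y (hW y)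
  have hb₁ : ∀ y, HasDerivAt (fun y => (W₁ y).im) ((W₂ y).im) y := fun y => by
    simpa [Function.comp_def] using Complex.imCLM.hasFDerivAt.comp_hasDerivAt y (hW₁ y)
  have hB : ∀ y, (W y).re ^ 2 + (W y).im ^ 2 ≤ C ^ 2 := by
    intro y
    have h1 : (W y).re ^ 2 + (W y).im ^ 2 = ‖W y‖ ^ 2 := by
      rw [← Complex.normSq_eq_norm_sq, Complex.normSq_apply]; ring
    rw [h1]
    exact pow_le_pow_left₀ (norm_nonneg _) (hC y) 2
  have heq' : ∀ y, (W₂ y).re * (W y).re + (W₂ y).im * (W y).im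
      = (y ^ 2 / 4 + μ) * ((W y).re ^ 2 + (W y).im ^ 2) := by
    intro y
    have e : W₂ y = (((y ^ 2 / 4 + μ : ℝ) : ℂ) + Complex.I * (ν y : ℂ)) * W y := by
      rw [heq y]; push_cast; ring
    rw [e]
    simp only [Complex.mul_re, Complex.mul_im, Complex.add_re, Complex.add_im, Complex.ofReal_re,
      Complex.ofReal_im, Complex.I_re, Complex.I_im]
    ring
  obtain ⟨h1, h2⟩ := weber_energy ha ha₁ hb hb₁ hB heq' hμ y₀
  exact Complex.ext (by simpa using h1) (by simpa using h2)

/-- **Registered sub-goal `resolventUnique_partB`** (part file B of `stub_resolventUnique`): the Weber energy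
lemma `weber_complex` in Pi-form. [folklore] -/
theorem resolventUnique_partB : ∀ (W W₁ W₂ : ℝ → ℂ) (μ C : ℝ) (ν : ℝ → ℝ), (∀ y, HasDerivAt W (W₁ y) y) → (∀ y, HasDerivAt W₁ (W₂ y) y) → (∀ y, ‖W y‖ ≤ C) → (∀ y, W₂ y = ((y : ℂ) ^ 2 / 4 + (μ : ℂ) + Complex.I * (ν y : ℂ)) * W y) → -1 / 2 < μ → ∀ y₀ : ℝ, W y₀ = 0 :=
  fun _ _ _ _ _ ν hW hW₁ hC heq hμ y₀ => weber_complex ν hW hW₁ hC heq hμ y₀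

end Summit.AnomalousDissipation.AnomalousDissipation.Theorems.BurgersLayerKH.Sheet.ResolventUnique

end
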